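/-
Copyright (c) 2026 the pub-hodgecm-mathlib formalisation cell (harness21).  Prover seat hodgecm-mathlib-LH4-p10 (g8) (valve hand on strike line L1, LEAD F0P6-plan
(g14) BATCH #172 (2), (ρ6a) (B-iii)): Track B «K2-LIT», hLiu418 = stmt-HodgeConjecture-24832 — FILE 2 of the Levi height square bound: `‖Λ g‖ ≤ C · ‖g‖²` for the
Levi homomorphism BY VALUE of ★ `exists_leviHom_blk_eq`.  THEOREMS ONLY.
-/
import Summits.HodgeConjecture.HodgeConjecture.Theorems.K2LiuAdelicHeightGLConjBound   -- ★ FILE 1 `exists_adelicHeightGL_map_conjAdele_le` (+ ★ `AdelicGLnGlue`, `AdelicHeightGLProofs`, VsVecHeight entries)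
import Summits.HodgeConjecture.HodgeConjecture.Theorems.K2LiuSiegelDoubledLeviMatrix    -- ★ `isUnit_det_gramRA` (+ `HA`, `blk`, `gramR`, `cayR`, `cayRinv`, `e₂`)
import Literature.NumberTheory.Automorphic.LeviEmbeddingGLHeight                      -- ★ `leviGL`, `one_sup_adelicHeightGL_leviGL_le`, `GLn.one_le_mul_archHeight_sq`
import HarnessLib

/-!
# Crux `HLiu418`, (ρ6a) height bricks, (B-iii) FILE 2: THE HEIGHT OF THE LEVI HOMOMORPHISM — `‖Λ g‖ ≤ C · ‖g‖²`

Cell `hodgecm-mathlib`, crux item hLiu418 = `stmt-HodgeConjecture-24832`; squad K2, strike line L1; LEAD F0P6-plan (g14) BATCH #172 (2) (B-iii); consumer = ★ p863374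
`K2LiuKindOneLineLeviRowHeight.hΛγ_of_heightBricks`'s hypothesis `hΛ` (desk R90-C10-p03 (g0) ∕ K2Liu-p14 (g4), (P-dec)).  Lane `--supports stmt-HodgeConjecture-24832
--as helper` (count-neutral).  THEOREMS ONLY (no `def`, no instance, no notation, no named-fact hypothesis, no `sorry`).

THE POINT.  ★ `K2LiuIntertwiningDeltaUnconditional.exists_leviHom_blk_eq` hands out a Levi homomorphism `Λ : GL_n(𝔸_L) →* H(𝔸) ≤ GL_{n+n}(𝔸_L)` BY VALUE:
`blk (Λ g) = R · diag(g, g♯) · R⁻¹`, `R = [[1,1],[1,−1]]` (★ `cayR`, `R⁻¹ = ½R` ★ `cayRinv`), `g♯ = T⁻¹ · ᵗ((c ⊗ 1) g⁻¹) · T` (`T = gramR ⊗ 1`).  This file bounds its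
Borel–Jacquet height (★ `AdelicGLnGlue.adelicHeightGL`):
* §1 TWO HEIGHT IDENTITIES ON `GL_n(𝔸_K)`: the height floor `1 ≤ n‖g‖` (★ `GLn.one_le_mul_archHeight_sq`, `∏_v H_v ≥ 1`), and `‖X‖ = ‖Y‖` whenever the entries of
  `(X, X⁻¹)` are those of `(Y⁻¹, Y)` transposed (the height is the sup over the entries of `g` AND `g⁻¹`) — applied to `X = ᵗ((c ⊗ 1) g⁻¹)`, `Y = (c ⊗ 1) g`.
* §2 **`exists_adelicHeightGL_leviHom_le_sq`** — for ANY map `Λ : GL_n(𝔸_L) → H(𝔸)` with the displayed `blk`-values: `∃ C ≥ 0, ∀ g, ‖(Λ g : GL_{n+n}(𝔸_L))‖ ≤ C·‖g‖²`.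
  Proof: `(Λ g : GL_{n+n}) = R̃ · leviGL(g, T̃⁻¹ · X_g · T̃) · R̃⁻¹` as units (`R̃ = reindex R`, `T̃ = T` as a unit by ★ `isUnit_det_gramRA`, `X_g = ᵗ((c ⊗ 1) g⁻¹)` with
  inverse `ᵗ((c ⊗ 1) g)`); then ★ `adelicHeightGL_mul_le_const` (`‖gh‖ ≤ n‖g‖‖h‖`), ★ `one_sup_adelicHeightGL_leviGL_le` (`1 ⊔ ‖diag(m₁,m₂)‖ ≤ 2n·n·n (1 ⊔ ‖m₁‖)(1 ⊔ ‖m₂‖)`),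
  §1 (`‖X_g‖ = ‖(c ⊗ 1) g‖`), ★ FILE 1 (`‖(c ⊗ 1) g‖ ≤ κ‖g‖`) and the floor (`1 ⊔ ‖g‖ ≤ n‖g‖`, `1 ⊔ c₂‖g‖ ≤ (n + c₂)‖g‖`).
HONEST LABEL.  Count-neutral helper: `HC_CM` is proved only modulo the 7 printed citations (2 remaining named inputs: hLiu418 = `stmt-HodgeConjecture-24832`,
h413 = `stmt-HodgeConjecture-24833`) until rung 0 closes.

## References
* [BorelJacquet1979] A. Borel, H. Jacquet, *Automorphic forms and automorphic representations*, Proc. Symp. Pure Math. 33 (1979), §1.2 (properties of the height).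
* [MoeglinWaldspurger1995] C. Mœglin, J.-L. Waldspurger, *Spectral decomposition and Eisenstein series* (1995), I.2.2 (heights on Levi subgroups).
* [HarrisKudlaSweet1996] M. Harris, S. Kudla, W. Sweet, *Theta dichotomy for unitary groups*, J. AMS 9 (1996), §1 (1.11) (the doubled Levi).
-/

set_option autoImplicit false
set_option linter.dupNamespace false -- the mandated namespace repeats `HodgeConjecture.HodgeConjecture`

noncomputable section

open scoped NNReal MatrixGroups Matrix Classical
open NumberField NumberField.mixedEmbedding IsDedekindDomain

namespace Summit.HodgeConjecture.HodgeConjecture.Cruxes.HLiu418.K2LiuLeviHomHeightBound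

open Literature.NumberTheory.Automorphic Literature.NumberTheory.Automorphic.UnitaryGroup Literature.NumberTheory.Automorphic.HCLevi
open Literature.NumberTheory.GelbartRogawski1991 Literature.NumberTheory.GelbartRogawski1991.GRConstruction
open Literature.NumberTheory.GelbartRogawski1991.AdaptedBlocks
open UnitaryDualPair
open Summit.HodgeConjecture.HodgeConjecture.Cruxes.HLiu418.K2LiuAdelicHeightGLVsVecHeight (toMixed_inv_coe_apply map_adeleEval_inv_coe_apply)
open Summit.HodgeConjecture.HodgeConjecture.Cruxes.HLiu418.K2LiuAdelicHeightGLConjBound (exists_adelicHeightGL_map_conjAdele_le)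
open Summit.HodgeConjecture.HodgeConjecture.Cruxes.HLiu418.K2LiuSiegelDoubledLeviMatrix (isUnit_det_gramRA)

/-! ## §1 Two height identities on `GL_n(𝔸_K)` -/

section GLn

variable {K : Type} [Field K] [NumberField K] {n : ℕ}

/-- **the height floor** `1 ≤ n · ‖g‖` (`n ≥ 1`): `1 ≤ n H_∞(g)²` (★ `GLn.one_le_mul_archHeight_sq`) gives `1 ≤ n H_∞(g)` in both cases `H_∞ ≶ 1`, and `∏_v H_v(g) ≥ 1`.
[cite: BorelJacquet1979, §1.2] -/
theorem one_le_mul_adelicHeightGL [NeZero n] (g : GL (Fin n) (AdeleRing (𝓞 K) K)) : 1 ≤ n * adelicHeightGL n K g := by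
  have hn1 : (1 : ℝ) ≤ n := by exact_mod_cast Nat.one_le_iff_ne_zero.2 (NeZero.ne n)
  have h1 := GLn.one_le_mul_archHeight_sq (K := K) g
  set A : ℝ := (GLn.archHeight n K g : ℝ) with hA
  have hA0 : 0 ≤ A := NNReal.coe_nonneg _
  have hAn : 1 ≤ n * A := by
    rcases le_or_gt 1 A with hA1 | hA1
    · exact hA1.trans (le_mul_of_one_le_left hA0 hn1)
    · exact h1.trans (mul_le_mul_of_nonneg_left (by rw [sq]; exact mul_le_of_le_one_left hA0 hA1.le) (zero_le_one.trans hn1))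
  calc (1 : ℝ) ≤ n * A := hAn
    _ ≤ n * A * ∏ᶠ v, (GLn.localHeight n K v g : ℝ) := le_mul_of_one_le_right (mul_nonneg (zero_le_one.trans hn1) hA0) (GLn.one_le_finprod_localHeight g)
    _ = n * adelicHeightGL n K g := by unfold adelicHeightGL; ring

/-- `1 ⊔ c · ‖g‖ ≤ (n + c) · ‖g‖` for `c ≥ 0` (the floor). [cite: BorelJacquet1979, §1.2] -/
theorem one_sup_mul_adelicHeightGL_le [NeZero n] {c : ℝ} (hc : 0 ≤ c) (g : GL (Fin n) (AdeleRing (𝓞 K) K)) :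
    1 ⊔ c * adelicHeightGL n K g ≤ (n + c) * adelicHeightGL n K g := by
  have hH := adelicHeightGL_nonneg g
  have hfl := one_le_mul_adelicHeightGL (K := K) g
  refine sup_le ?_ ?_
  · calc (1 : ℝ) ≤ n * adelicHeightGL n K g := hfl
      _ ≤ (n + c) * adelicHeightGL n K g := mul_le_mul_of_nonneg_right (le_add_of_nonneg_right hc) hH
  · exact mul_le_mul_of_nonneg_right (le_add_of_nonneg_left (Nat.cast_nonneg n)) hH

/-- **`‖X‖ = ‖Y‖` when the entries of `(X, X⁻¹)` are those of `(Y⁻¹, Y)` transposed** (the height is the sup of the local sizes of the entries of `g` and `g⁻¹`,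
symmetric in the two and blind to the position). [cite: BorelJacquet1979, §1.2] -/
theorem adelicHeightGL_eq_of_transpose_swap (X Y : GL (Fin n) (AdeleRing (𝓞 K) K))
    (h₁ : ∀ i j, (X : Matrix (Fin n) (Fin n) (AdeleRing (𝓞 K) K)) i j = ((Y⁻¹ : GL (Fin n) (AdeleRing (𝓞 K) K)) : Matrix (Fin n) (Fin n) (AdeleRing (𝓞 K) K)) j i)
    (h₂ : ∀ i j, ((X⁻¹ : GL (Fin n) (AdeleRing (𝓞 K) K)) : Matrix (Fin n) (Fin n) (AdeleRing (𝓞 K) K)) i j = (Y : Matrix (Fin n) (Fin n) (AdeleRing (𝓞 K) K)) j i) :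
    adelicHeightGL n K X = adelicHeightGL n K Y := by
  have harch : GLn.archHeight n K X = GLn.archHeight n K Y := by
    unfold GLn.archHeight
    conv_rhs => rw [← Finset.map_univ_equiv (Equiv.prodComm (Fin n) (Fin n)), Finset.sup_map]
    refine Finset.sup_congr rfl fun ij _ => ?_
    have e1 : ((GLn.toMixed n K X : GL (Fin n) (mixedSpace K)) : Matrix (Fin n) (Fin n) (mixedSpace K)) ij.1 ij.2 =
        (((GLn.toMixed n K Y)⁻¹ : GL (Fin n) (mixedSpace K)) : Matrix (Fin n) (Fin n) (mixedSpace K)) ij.2 ij.1 := by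
      rw [toMixed_inv_coe_apply, ← h₁]; rfl
    have e2 : (((GLn.toMixed n K X)⁻¹ : GL (Fin n) (mixedSpace K)) : Matrix (Fin n) (Fin n) (mixedSpace K)) ij.1 ij.2 =
        ((GLn.toMixed n K Y : GL (Fin n) (mixedSpace K)) : Matrix (Fin n) (Fin n) (mixedSpace K)) ij.2 ij.1 := by
      rw [toMixed_inv_coe_apply, h₂]; rfl
    rw [e1, e2, max_comm]
    rfl
  have hloc : ∀ v, GLn.localHeight n K v X = GLn.localHeight n K v Y := fun v => by
    unfold GLn.localHeight
    conv_rhs => rw [← Finset.map_univ_equiv (Equiv.prodComm (Fin n) (Fin n)), Finset.sup_map]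
    refine Finset.sup_congr rfl fun ij _ => ?_
    have e1 : ((Matrix.GeneralLinearGroup.map (AdelicGroupData.adeleEval K v) X : GL (Fin n) (v.adicCompletion K)) :
          Matrix (Fin n) (Fin n) (v.adicCompletion K)) ij.1 ij.2 =
        (((Matrix.GeneralLinearGroup.map (AdelicGroupData.adeleEval K v) Y)⁻¹ : GL (Fin n) (v.adicCompletion K)) :
          Matrix (Fin n) (Fin n) (v.adicCompletion K)) ij.2 ij.1 := by
      rw [map_adeleEval_inv_coe_apply, ← h₁]; rfl
    have e2 : (((Matrix.GeneralLinearGroup.map (AdelicGroupData.adeleEval K v) X)⁻¹ : GL (Fin n) (v.adicCompletion K)) :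
          Matrix (Fin n) (Fin n) (v.adicCompletion K)) ij.1 ij.2 =
        ((Matrix.GeneralLinearGroup.map (AdelicGroupData.adeleEval K v) Y : GL (Fin n) (v.adicCompletion K)) :
          Matrix (Fin n) (Fin n) (v.adicCompletion K)) ij.2 ij.1 := by
      rw [map_adeleEval_inv_coe_apply, h₂]; rfl
    rw [e1, e2, max_comm]
    rfl
  unfold adelicHeightGL
  rw [harch]
  congr 1
  exact finprod_congr fun v => by rw [hloc v]

/-- **THE LEVI HEIGHT LEMMA on `GL_n(𝔸_K)`** — let `R, R⁻¹ ∈ M_{n⊔n}(𝔸_K)` be mutually inverse, `T ∈ M_n(𝔸_K)` with unit determinant, `σ` a ring endomorphism of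
`𝔸_K` whose action on `GL_n` is height-bounded (`‖σ g‖ ≤ κ‖g‖`), and `Λ : GL_n(𝔸_K) → GL_{n+n}(𝔸_K)` ANY map with `Λ g = R · diag(g, T⁻¹ ᵗ(σ g⁻¹) T) · R⁻¹` in the block
enumeration `Fin n ⊕ Fin n`; then `‖Λ g‖ ≤ C‖g‖²` with ONE `C ≥ 0` (`n ≥ 1`).  Proof: `Λ g = R̃ · leviGL(g, T̃⁻¹ X_g T̃) · R̃⁻¹` as units (`X_g = ᵗ(σ g⁻¹)`, inverse
`ᵗ(σ g)`), ★ `adelicHeightGL_mul_le_const`, ★ `one_sup_adelicHeightGL_leviGL_le`, `‖X_g‖ = ‖σ g‖` (`adelicHeightGL_eq_of_transpose_swap`) and the floor.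
[cite: MoeglinWaldspurger1995, I.2.2] [cite: BorelJacquet1979, §1.2] -/
theorem exists_adelicHeightGL_le_sq_of_levi [NeZero n] (R Rinv : Matrix (Fin n ⊕ Fin n) (Fin n ⊕ Fin n) (AdeleRing (𝓞 K) K))
    (hRR : R * Rinv = 1) (hRR' : Rinv * R = 1) (T : Matrix (Fin n) (Fin n) (AdeleRing (𝓞 K) K)) (hT : IsUnit T.det)
    (σ : AdeleRing (𝓞 K) K →+* AdeleRing (𝓞 K) K) (κ : ℝ) (hκ0 : 0 ≤ κ)
    (hκ : ∀ g : GL (Fin n) (AdeleRing (𝓞 K) K), adelicHeightGL n K (Matrix.GeneralLinearGroup.map σ g) ≤ κ * adelicHeightGL n K g)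
    (Λ : GL (Fin n) (AdeleRing (𝓞 K) K) → GL (Fin (n + n)) (AdeleRing (𝓞 K) K))
    (hΛ : ∀ g : GL (Fin n) (AdeleRing (𝓞 K) K),
      Matrix.reindex finSumFinEquiv.symm finSumFinEquiv.symm ((Λ g : GL (Fin (n + n)) (AdeleRing (𝓞 K) K)) : Matrix (Fin (n + n)) (Fin (n + n)) (AdeleRing (𝓞 K) K)) =
        R * Matrix.fromBlocks (g : Matrix (Fin n) (Fin n) (AdeleRing (𝓞 K) K)) 0 0
          (T⁻¹ * (((g⁻¹ : GL (Fin n) (AdeleRing (𝓞 K) K)) : Matrix (Fin n) (Fin n) (AdeleRing (𝓞 K) K)).map σ)ᵀ * T) * Rinv) :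
    ∃ C : ℝ, 0 ≤ C ∧ ∀ g : GL (Fin n) (AdeleRing (𝓞 K) K), adelicHeightGL (n + n) K (Λ g) ≤ C * adelicHeightGL n K g ^ 2 := by
  -- the constants `T̃ = T`, `R̃ = reindex R` as units
  let Tu : GL (Fin n) (AdeleRing (𝓞 K) K) := Matrix.nonsingInvUnit T hT
  have hTu : (Tu : Matrix (Fin n) (Fin n) (AdeleRing (𝓞 K) K)) = T := rfl
  have hTu' : ((Tu⁻¹ : GL (Fin n) (AdeleRing (𝓞 K) K)) : Matrix (Fin n) (Fin n) (AdeleRing (𝓞 K) K)) = T⁻¹ := rfl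
  let Ru : GL (Fin (n + n)) (AdeleRing (𝓞 K) K) :=
    { val := Matrix.reindex finSumFinEquiv finSumFinEquiv R
      inv := Matrix.reindex finSumFinEquiv finSumFinEquiv Rinv
      val_inv := by rw [Matrix.reindex_apply, Matrix.reindex_apply, Matrix.submatrix_mul_equiv, hRR, Matrix.submatrix_one_equiv]
      inv_val := by rw [Matrix.reindex_apply, Matrix.reindex_apply, Matrix.submatrix_mul_equiv, hRR', Matrix.submatrix_one_equiv] }
  have hRu : (Ru : Matrix (Fin (n + n)) (Fin (n + n)) (AdeleRing (𝓞 K) K)) = Matrix.reindex finSumFinEquiv finSumFinEquiv R := rfl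
  have hRu' : ((Ru⁻¹ : GL (Fin (n + n)) (AdeleRing (𝓞 K) K)) : Matrix (Fin (n + n)) (Fin (n + n)) (AdeleRing (𝓞 K) K)) =
      Matrix.reindex finSumFinEquiv finSumFinEquiv Rinv := rfl
  -- `X_g = ᵗ(σ g⁻¹)` as a unit with inverse `ᵗ(σ g)`
  have hval : ∀ g : GL (Fin n) (AdeleRing (𝓞 K) K),
      (((g⁻¹ : GL (Fin n) (AdeleRing (𝓞 K) K)) : Matrix (Fin n) (Fin n) (AdeleRing (𝓞 K) K)).map σ)ᵀ *
        ((g : Matrix (Fin n) (Fin n) (AdeleRing (𝓞 K) K)).map σ)ᵀ = 1 := fun g => by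
    rw [← Matrix.transpose_mul, ← Matrix.map_mul, ← Units.val_mul, mul_inv_cancel, Units.val_one, Matrix.map_one σ (map_zero σ) (map_one σ),
      Matrix.transpose_one]
  have hinv : ∀ g : GL (Fin n) (AdeleRing (𝓞 K) K),
      ((g : Matrix (Fin n) (Fin n) (AdeleRing (𝓞 K) K)).map σ)ᵀ *
        (((g⁻¹ : GL (Fin n) (AdeleRing (𝓞 K) K)) : Matrix (Fin n) (Fin n) (AdeleRing (𝓞 K) K)).map σ)ᵀ = 1 := fun g => by
    rw [← Matrix.transpose_mul, ← Matrix.map_mul, ← Units.val_mul, inv_mul_cancel, Units.val_one, Matrix.map_one σ (map_zero σ) (map_one σ),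
      Matrix.transpose_one]
  let X : GL (Fin n) (AdeleRing (𝓞 K) K) → GL (Fin n) (AdeleRing (𝓞 K) K) := fun g =>
    { val := (((g⁻¹ : GL (Fin n) (AdeleRing (𝓞 K) K)) : Matrix (Fin n) (Fin n) (AdeleRing (𝓞 K) K)).map σ)ᵀ
      inv := ((g : Matrix (Fin n) (Fin n) (AdeleRing (𝓞 K) K)).map σ)ᵀ
      val_inv := hval g
      inv_val := hinv g }
  have hXv : ∀ g, (X g : Matrix (Fin n) (Fin n) (AdeleRing (𝓞 K) K)) =
      (((g⁻¹ : GL (Fin n) (AdeleRing (𝓞 K) K)) : Matrix (Fin n) (Fin n) (AdeleRing (𝓞 K) K)).map σ)ᵀ := fun g => rfl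
  -- `‖X_g‖ = ‖σ g‖ ≤ κ ‖g‖`
  have hX : ∀ g, adelicHeightGL n K (X g) ≤ κ * adelicHeightGL n K g := fun g => by
    rw [adelicHeightGL_eq_of_transpose_swap (X g) (Matrix.GeneralLinearGroup.map σ g) (fun _ _ => rfl) (fun _ _ => rfl)]
    exact hκ g
  -- the factorisation `Λ g = R̃ · leviGL(g, T̃⁻¹ X_g T̃) · R̃⁻¹`
  have hfac : ∀ g : GL (Fin n) (AdeleRing (𝓞 K) K), Λ g = Ru * leviGL (AdeleRing (𝓞 K) K) n n (g, Tu⁻¹ * X g * Tu) * Ru⁻¹ := fun g => by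
    refine Units.ext ?_
    have h := congrArg (Matrix.reindex finSumFinEquiv finSumFinEquiv) (hΛ g)
    simp only [Matrix.reindex_apply, Equiv.symm_symm, Matrix.submatrix_submatrix, Equiv.self_comp_symm, Matrix.submatrix_id_id] at h
    rw [h]
    simp only [Units.val_mul, coe_leviGL, hRu, hRu', hTu, hTu', hXv, blockDiag', Matrix.reindex_apply, Matrix.submatrix_mul_equiv]
  -- the heights of the constants; `‖g♯‖ ≤ c₂ ‖g‖`
  have hn1 : (1 : ℝ) ≤ n := by exact_mod_cast Nat.one_le_iff_ne_zero.2 (NeZero.ne n)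
  have hn0 : (0 : ℝ) ≤ n := zero_le_one.trans hn1
  have hN0 : (0 : ℝ) ≤ (n + n : ℕ) := Nat.cast_nonneg _
  have hHR0 : 0 ≤ adelicHeightGL (n + n) K Ru := adelicHeightGL_nonneg _
  have hHR'0 : 0 ≤ adelicHeightGL (n + n) K Ru⁻¹ := adelicHeightGL_nonneg _
  have hHT0 : 0 ≤ adelicHeightGL n K Tu := adelicHeightGL_nonneg _
  have hHT'0 : 0 ≤ adelicHeightGL n K Tu⁻¹ := adelicHeightGL_nonneg _
  have hc₂0 : 0 ≤ n * n * adelicHeightGL n K Tu⁻¹ * adelicHeightGL n K Tu * κ :=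
    mul_nonneg (mul_nonneg (mul_nonneg (mul_nonneg hn0 hn0) hHT'0) hHT0) hκ0
  have hsharp : ∀ g, adelicHeightGL n K (Tu⁻¹ * X g * Tu) ≤ (n * n * adelicHeightGL n K Tu⁻¹ * adelicHeightGL n K Tu * κ) * adelicHeightGL n K g :=
      fun g => by
    calc adelicHeightGL n K (Tu⁻¹ * X g * Tu) ≤ n * adelicHeightGL n K (Tu⁻¹ * X g) * adelicHeightGL n K Tu := adelicHeightGL_mul_le_const _ _
      _ ≤ n * (n * adelicHeightGL n K Tu⁻¹ * adelicHeightGL n K (X g)) * adelicHeightGL n K Tu :=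
          mul_le_mul_of_nonneg_right (mul_le_mul_of_nonneg_left (adelicHeightGL_mul_le_const _ _) hn0) hHT0
      _ = n * n * adelicHeightGL n K Tu⁻¹ * adelicHeightGL n K Tu * adelicHeightGL n K (X g) := by ring
      _ ≤ n * n * adelicHeightGL n K Tu⁻¹ * adelicHeightGL n K Tu * (κ * adelicHeightGL n K g) :=
          mul_le_mul_of_nonneg_left (hX g) (mul_nonneg (mul_nonneg (mul_nonneg hn0 hn0) hHT'0) hHT0)
      _ = (n * n * adelicHeightGL n K Tu⁻¹ * adelicHeightGL n K Tu * κ) * adelicHeightGL n K g := by ring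
  -- assembly
  have hB0 : (0 : ℝ) ≤ ((n + n : ℕ) * n * n : ℝ) := mul_nonneg (mul_nonneg hN0 hn0) hn0
  have hA0 : 0 ≤ (n + n : ℕ) * (n + n : ℕ) * adelicHeightGL (n + n) K Ru * adelicHeightGL (n + n) K Ru⁻¹ * ((n + n : ℕ) * n * n : ℝ) :=
    mul_nonneg (mul_nonneg (mul_nonneg (mul_nonneg hN0 hN0) hHR0) hHR'0) hB0
  refine ⟨(n + n : ℕ) * (n + n : ℕ) * adelicHeightGL (n + n) K Ru * adelicHeightGL (n + n) K Ru⁻¹ * ((n + n : ℕ) * n * n : ℝ) * n *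
      (n + n * n * adelicHeightGL n K Tu⁻¹ * adelicHeightGL n K Tu * κ), mul_nonneg (mul_nonneg hA0 hn0) (add_nonneg hn0 hc₂0), fun g => ?_⟩
  have hH := adelicHeightGL_nonneg (n := n) (K := K) g
  have hlevi := one_sup_adelicHeightGL_leviGL_le (K := K) g (Tu⁻¹ * X g * Tu)
  have h1g : 1 ⊔ adelicHeightGL n K g ≤ n * adelicHeightGL n K g :=
    sup_le (one_le_mul_adelicHeightGL (K := K) g) (le_mul_of_one_le_left hH hn1)
  have h2g : 1 ⊔ adelicHeightGL n K (Tu⁻¹ * X g * Tu) ≤ (n + n * n * adelicHeightGL n K Tu⁻¹ * adelicHeightGL n K Tu * κ) * adelicHeightGL n K g :=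
    (sup_le_sup_left (hsharp g) 1).trans (one_sup_mul_adelicHeightGL_le (K := K) hc₂0 g)
  have h10 : (0 : ℝ) ≤ 1 ⊔ adelicHeightGL n K g := zero_le_one.trans le_sup_left
  have hlev0 : (0 : ℝ) ≤ adelicHeightGL (n + n) K (leviGL (AdeleRing (𝓞 K) K) n n (g, Tu⁻¹ * X g * Tu)) := adelicHeightGL_nonneg _
  calc adelicHeightGL (n + n) K (Λ g)
      = adelicHeightGL (n + n) K (Ru * leviGL (AdeleRing (𝓞 K) K) n n (g, Tu⁻¹ * X g * Tu) * Ru⁻¹) := by rw [hfac g]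
    _ ≤ (n + n : ℕ) * adelicHeightGL (n + n) K (Ru * leviGL (AdeleRing (𝓞 K) K) n n (g, Tu⁻¹ * X g * Tu)) * adelicHeightGL (n + n) K Ru⁻¹ :=
        adelicHeightGL_mul_le_const _ _
    _ ≤ (n + n : ℕ) * ((n + n : ℕ) * adelicHeightGL (n + n) K Ru * adelicHeightGL (n + n) K (leviGL (AdeleRing (𝓞 K) K) n n (g, Tu⁻¹ * X g * Tu))) *
          adelicHeightGL (n + n) K Ru⁻¹ :=
        mul_le_mul_of_nonneg_right (mul_le_mul_of_nonneg_left (adelicHeightGL_mul_le_const _ _) hN0) hHR'0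
    _ ≤ (n + n : ℕ) * ((n + n : ℕ) * adelicHeightGL (n + n) K Ru * (((n + n : ℕ) * n * n : ℝ) * (1 ⊔ adelicHeightGL n K g) *
          (1 ⊔ adelicHeightGL n K (Tu⁻¹ * X g * Tu)))) * adelicHeightGL (n + n) K Ru⁻¹ :=
        mul_le_mul_of_nonneg_right (mul_le_mul_of_nonneg_left (mul_le_mul_of_nonneg_left (le_sup_right.trans hlevi) (mul_nonneg hN0 hHR0)) hN0) hHR'0
    _ = (n + n : ℕ) * (n + n : ℕ) * adelicHeightGL (n + n) K Ru * adelicHeightGL (n + n) K Ru⁻¹ * ((n + n : ℕ) * n * n : ℝ) *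
          ((1 ⊔ adelicHeightGL n K g) * (1 ⊔ adelicHeightGL n K (Tu⁻¹ * X g * Tu))) := by ring
    _ ≤ (n + n : ℕ) * (n + n : ℕ) * adelicHeightGL (n + n) K Ru * adelicHeightGL (n + n) K Ru⁻¹ * ((n + n : ℕ) * n * n : ℝ) *
          ((n * adelicHeightGL n K g) * ((n + n * n * adelicHeightGL n K Tu⁻¹ * adelicHeightGL n K Tu * κ) * adelicHeightGL n K g)) :=
        mul_le_mul_of_nonneg_left (mul_le_mul h1g h2g (zero_le_one.trans le_sup_left) (mul_nonneg hn0 hH)) hA0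
    _ = (n + n : ℕ) * (n + n : ℕ) * adelicHeightGL (n + n) K Ru * adelicHeightGL (n + n) K Ru⁻¹ * ((n + n : ℕ) * n * n : ℝ) * n *
          (n + n * n * adelicHeightGL n K Tu⁻¹ * adelicHeightGL n K Tu * κ) * adelicHeightGL n K g ^ 2 := by ring

end GLn

/-! ## §2 The Levi homomorphism of the doubled unitary group: `‖Λ g‖ ≤ C · ‖g‖²` -/

section Levi

variable (L : Type) [Field L] [NumberField L] [IsCMField L]
variable {N M n : ℕ} (e : Fin N × Fin M ≃ Fin n)
  (dV : Fin N → L) (hdV : ∀ i, IsCMField.complexConj L (dV i) = dV i)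
  (dW : Fin M → L) (hdW : ∀ i, IsCMField.complexConj L (dW i) = dW i)

/-- **`‖Λ g‖ ≤ C · ‖g‖²`** — for every map `Λ : GL_n(𝔸_L) → H(𝔸)` with the Levi values `blk (Λ g) = R · diag(g, T⁻¹ ᵗ((c ⊗ 1) g⁻¹) T) · R⁻¹` of
★ `exists_leviHom_blk_eq` (BY VALUE; `n ≥ 1`, `dV, dW ≠ 0`), there is ONE `C ≥ 0` with `‖(Λ g : GL_{n+n}(𝔸_L))‖ ≤ C · ‖g‖²` for all `g` — the hypothesis `hΛ` of
★ `K2LiuKindOneLineLeviRowHeight.hΛγ_of_heightBricks` at `Λ := fun g => (Λ g : GL (Fin (n + n)) (AdeleRing (𝓞 L) L))` (§1 `exists_adelicHeightGL_le_sq_of_levi` at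
`R, R⁻¹ := cayR, cayRinv`, `T := gramR ⊗ 1` (★ `isUnit_det_gramRA`), `σ := c ⊗ 1` (★ FILE 1 `exists_adelicHeightGL_map_conjAdele_le`)).
[cite: MoeglinWaldspurger1995, I.2.2] [cite: BorelJacquet1979, §1.2] [cite: HarrisKudlaSweet1996, §1 (1.11)] -/
theorem exists_adelicHeightGL_leviHom_le_sq [NeZero n] (hdV0 : ∀ i, dV i ≠ 0) (hdW0 : ∀ i, dW i ≠ 0)
    (Λ : GL (Fin n) (AdeleRing (𝓞 L) L) → HA L e dV hdV dW hdW)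
    (hΛ : ∀ g : GL (Fin n) (AdeleRing (𝓞 L) L), blk L e dV hdV dW hdW (Λ g) =
      cayR (AdeleRing (𝓞 L) L) (Fin n) * Matrix.fromBlocks (g : Matrix (Fin n) (Fin n) (AdeleRing (𝓞 L) L)) 0 0
        (((gramR L e dV hdV dW hdW).map ((algebraMap L (AdeleRing (𝓞 L) L)).comp (algebraMap (Fp L) L)))⁻¹ *
          (((g⁻¹ : GL (Fin n) (AdeleRing (𝓞 L) L)) : Matrix (Fin n) (Fin n) (AdeleRing (𝓞 L) L)).map
            (conjAdele (Fp L) L (IsCMField.complexConj L)))ᵀ *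
          (gramR L e dV hdV dW hdW).map ((algebraMap L (AdeleRing (𝓞 L) L)).comp (algebraMap (Fp L) L))) *
        cayRinv (AdeleRing (𝓞 L) L) (Fin n)) :
    ∃ C : ℝ, 0 ≤ C ∧ ∀ g : GL (Fin n) (AdeleRing (𝓞 L) L),
      adelicHeightGL (n + n) L (Λ g : GL (Fin (n + n)) (AdeleRing (𝓞 L) L)) ≤ C * adelicHeightGL n L g ^ 2 := by
  obtain ⟨κ, hκ0, hκ⟩ := exists_adelicHeightGL_map_conjAdele_le (F := Fp L) (E := L) (IsCMField.complexConj L) (n := n)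
  exact exists_adelicHeightGL_le_sq_of_levi (cayR (AdeleRing (𝓞 L) L) (Fin n)) (cayRinv (AdeleRing (𝓞 L) L) (Fin n)) cayR_mul_cayRinv cayRinv_mul_cayR
    _ (isUnit_det_gramRA L e dV hdV dW hdW hdV0 hdW0) (conjAdele (Fp L) L (IsCMField.complexConj L)) κ hκ0 hκ
    (fun g => (Λ g : GL (Fin (n + n)) (AdeleRing (𝓞 L) L))) hΛ

end Levi

end Summit.HodgeConjecture.HodgeConjecture.Cruxes.HLiu418.K2LiuLeviHomHeightBound

end
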